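import Summits.FinalStateConjecture.FinalStateConjecture.Theorems.PhotonSphereChannelsTameEternalLimitDefs
import Literature.Geometry.Lorentzian.CauchyDevelopmentPieceDomain
import HarnessLib

/-!
# Crux `ChannelsResolveTameDevelopmentsR` (stmt-FinalStateConjecture-14075), line
# `trapped-set-observability-analyticity` — stub `stub_omegaLimits` (S1): structural lemmas

Helpers for the EXTRACTION stub S1 (`stub_omegaLimits`: along every escaping sequence of base
points of the outer region of a tame MGHD there is a `TameEternalLimit` arising from it), over the
landed vocabulary `Theorems.TrappedSet` (`PhotonSphereChannelsTameEternalLimitDefs.lean`) and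
`Literature.Geometry.Lorentzian.SpacetimeLocalConvergence`:

* §1 companions of the proved `LocalSubconvergence.subseq` / `.mono` for the far-chart clause
  (`farChartsConverge_subseq`, `farChartsConverge_mono`) and the bundled `Prop`
  (`subconvergesLocallyWithFarChartsTo_mono`: `Cᵏ` ⇒ `Cᵏ'` for `k' ≤ k`);
* §2 UN-SUBSEQUENCING: if a subsequence `(𝓢_{ρ m}, p_{ρ m})` subconverges (with far charts) then so
  does the original sequence (`subconvergesLocallyTo_of_comp_strictMono`,
  `subconvergesLocallyWithFarChartsTo_of_comp_strictMono`) — the direction an extraction proof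
  uses ("pass to a subsequence first"); the converse (heredity to arbitrary subsequences) is false
  for SUBconvergence and is not claimed;
* §3 the S1-level corollaries: `IsEscaping` and membership in the outer region pass to
  subsequences, `ArisesFrom` descends from a subsequence (`TameEternalLimit.arisesFrom_of_comp_strictMono`),
  hence the WLOG reduction `exists_arisesFrom_of_comp_strictMono` (registered sub-goal
  `stub_omegaLimitsOfSubseq`): to prove S1 along `p` it suffices to prove it along one subsequence;
* §4 audit lemmas on `IsEscaping` (it is stated through the honest time separation
  `Spacetime.lorentzDist`): an escaping sequence eventually lies in `J⁺(ι X)` with POSITIVE time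
  separation from `ι X` (`IsEscaping.eventually_exists_lorentzDist_ne_zero`), and NO sequence of
  points of the Cauchy hypersurface itself escapes (`not_isEscaping_of_mem_range_embed`, from the
  acausality of `ι X`, `CauchyDevelopment.false_of_isFutureCausalCurveOn_range_embed`) — so the
  hypothesis `IsEscaping` of S1 is not universal (registered sub-goal `stub_notIsEscapingOnSigma`).
-/

set_option linter.dupNamespace false

noncomputable section

namespace Summit.FinalStateConjecture.FinalStateConjecture.Theorems.TrappedSet

open Literature.Geometry.Lorentzian
open scoped Manifold ContDiff Topology ENNReal NNReal
open Filter Set Function TopologicalSpace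

universe u v

/-! ## §1 Far charts along further subsequences / lower differentiability -/

section FarCharts

variable {𝓢ₙ : ℕ → Spacetime.{u} 4} {pₙ : ∀ n, (𝓢ₙ n).carrier} {𝓢 : Spacetime.{v} 4}
  {p : 𝓢.carrier} {k : ℕ} {B : ModelBackground}
  {Φₙ : ∀ n, B.domain → (𝓢ₙ n).carrier} {Φ : B.domain → 𝓢.carrier}

/-- **Far charts converge along every further subsequence**: the companion of
`LocalSubconvergence.subseq` for the far-chart clause (both clauses are composed with the strictly
increasing `ρ`, which tends to `atTop`). [folklore] -/
theorem farChartsConverge_subseq {D : Spacetime.LocalSubconvergence 𝓢ₙ pₙ 𝓢 p k}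
    (h : D.FarChartsConverge B Φₙ Φ) (ρ : ℕ → ℕ) (hρ : StrictMono ρ) :
    (D.subseq ρ hρ).FarChartsConverge B Φₙ Φ where
  eventually_embed_comp_eq K hK hKB :=
    hρ.tendsto_atTop.eventually (h.eventually_embed_comp_eq K hK hKB)
  tendsto_supCkENorm_deviationExtend K hK hKB :=
    (h.tendsto_supCkENorm_deviationExtend K hK hKB).comp hρ.tendsto_atTop

/-- **Far charts converge in `Cᵏ'` for `k' ≤ k`**: the companion of `LocalSubconvergence.mono`
(`supCkENorm` is monotone in the order). [folklore] -/
theorem farChartsConverge_mono {D : Spacetime.LocalSubconvergence 𝓢ₙ pₙ 𝓢 p k}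
    (h : D.FarChartsConverge B Φₙ Φ) {k' : ℕ} (hk : k' ≤ k) :
    (D.mono hk).FarChartsConverge B Φₙ Φ where
  eventually_embed_comp_eq K hK hKB := h.eventually_embed_comp_eq K hK hKB
  tendsto_supCkENorm_deviationExtend K hK hKB :=
    tendsto_of_tendsto_of_tendsto_of_le_of_le tendsto_const_nhds
      (h.tendsto_supCkENorm_deviationExtend K hK hKB) (fun _ ↦ zero_le)
      fun _ ↦ supCkENorm_mono_right _ hk _

/-- **Monotonicity in `k` with far charts**: pointed `Cᵏ_loc` subconvergence with far charts
implies pointed `Cᵏ'_loc` subconvergence with the same far charts for `k' ≤ k`. [folklore] -/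
theorem subconvergesLocallyWithFarChartsTo_mono
    (h : Spacetime.SubconvergesLocallyWithFarChartsTo 𝓢ₙ pₙ 𝓢 p k B Φₙ Φ) {k' : ℕ} (hk : k' ≤ k) :
    Spacetime.SubconvergesLocallyWithFarChartsTo 𝓢ₙ pₙ 𝓢 p k' B Φₙ Φ :=
  h.elim fun D hD ↦ ⟨D.mono hk, farChartsConverge_mono hD hk⟩

/-! ## §2 Un-subsequencing: subconvergence of a subsequence is subconvergence of the sequence -/

/-- **Un-subsequencing (plain form).** If the subsequence `m ↦ (𝓢ₙ (ρ m), pₙ (ρ m))` of a sequence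
of pointed spacetimes subconverges to `(𝓢, p)` in `Cᵏ_loc`, so does the sequence itself: the datum
is the same with `sub ↦ ρ ∘ sub`. (Petersen 2006, Ch. 10 §3.2: a subsequence of a subsequence is a
subsequence.) [folklore] -/
theorem subconvergesLocallyTo_of_comp_strictMono (ρ : ℕ → ℕ) (hρ : StrictMono ρ)
    (h : Spacetime.SubconvergesLocallyTo (fun m ↦ 𝓢ₙ (ρ m)) (fun m ↦ pₙ (ρ m)) 𝓢 p k) :
    Spacetime.SubconvergesLocallyTo 𝓢ₙ pₙ 𝓢 p k := by
  obtain ⟨D⟩ := h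
  exact ⟨{ sub := ρ ∘ D.sub
           strictMono_sub := hρ.comp D.strictMono_sub
           U := D.U
           monotone_U := D.monotone_U
           mem_U := D.mem_U
           iUnion_U := D.iUnion_U
           isCompact_closure_U := D.isCompact_closure_U
           embed := D.embed
           isLocalDiffeomorphOn_embed := D.isLocalDiffeomorphOn_embed
           injOn_embed := D.injOn_embed
           embed_basepoint := D.embed_basepoint
           isFutureDirected_mfderiv_embed := D.isFutureDirected_mfderiv_embed
           tendsto_supCkENorm := D.tendsto_supCkENorm }⟩

/-- **Un-subsequencing with far charts.** If the subsequence `m ↦ (𝓢ₙ (ρ m), pₙ (ρ m))`, with the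
far charts `m ↦ Φₙ (ρ m)`, subconverges with far charts to `(𝓢, p, Φ)`, then so does the whole
sequence with the far charts `Φₙ` (same datum, `sub ↦ ρ ∘ sub`; both far-chart clauses are
literally the given ones). [folklore] -/
theorem subconvergesLocallyWithFarChartsTo_of_comp_strictMono (ρ : ℕ → ℕ) (hρ : StrictMono ρ)
    (h : Spacetime.SubconvergesLocallyWithFarChartsTo (fun m ↦ 𝓢ₙ (ρ m)) (fun m ↦ pₙ (ρ m)) 𝓢 p k
      B (fun m ↦ Φₙ (ρ m)) Φ) :
    Spacetime.SubconvergesLocallyWithFarChartsTo 𝓢ₙ pₙ 𝓢 p k B Φₙ Φ := by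
  obtain ⟨D, hD⟩ := h
  exact ⟨{ sub := ρ ∘ D.sub
           strictMono_sub := hρ.comp D.strictMono_sub
           U := D.U
           monotone_U := D.monotone_U
           mem_U := D.mem_U
           iUnion_U := D.iUnion_U
           isCompact_closure_U := D.isCompact_closure_U
           embed := D.embed
           isLocalDiffeomorphOn_embed := D.isLocalDiffeomorphOn_embed
           injOn_embed := D.injOn_embed
           embed_basepoint := D.embed_basepoint
           isFutureDirected_mfderiv_embed := D.isFutureDirected_mfderiv_embed
           tendsto_supCkENorm := D.tendsto_supCkENorm },
    { eventually_embed_comp_eq := hD.eventually_embed_comp_eq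
      tendsto_supCkENorm_deviationExtend := hD.tendsto_supCkENorm_deviationExtend }⟩

end FarCharts

/-! ## §3 S1-level corollaries: escaping sequences, outer region, `ArisesFrom` -/

section Development

variable {X : Type} [TopologicalSpace X] [ChartedSpace Literature.Geometry.Lorentzian.E3 X]
  [IsManifold (modelWithCornersSelf ℝ Literature.Geometry.Lorentzian.E3) ((⊤ : ℕ∞) : WithTop ℕ∞) X]
  [ConnectedSpace X]
  {D : Literature.Geometry.Lorentzian.InitialDataSet (modelWithCornersSelf ℝ Literature.Geometry.Lorentzian.E3) X}

/-- **Escaping passes to subsequences**: if the time separation of `p n` from `ι X` tends to `∞`,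
so does that of `p (ρ m)` for strictly increasing `ρ`. [folklore] -/
theorem IsEscaping.comp_strictMono {𝒟 : CauchyDevelopment D} {p : ℕ → 𝒟.carrier}
    (h : IsEscaping 𝒟 p) (ρ : ℕ → ℕ) (hρ : StrictMono ρ) : IsEscaping 𝒟 (p ∘ ρ) :=
  fun T ↦ hρ.tendsto_atTop.eventually (h T)

/-- Membership of all terms in a set (e.g. the outer region) passes to subsequences. [folklore] -/
theorem forall_comp_mem {𝒟 : CauchyDevelopment D} {p : ℕ → 𝒟.carrier} {S : Set 𝒟.carrier}
    (h : ∀ n, p n ∈ S) (ρ : ℕ → ℕ) : ∀ m, (p ∘ ρ) m ∈ S :=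
  fun m ↦ h (ρ m)

/-- **`ArisesFrom` descends from a subsequence of the base points.** If the tame eternal limit `E`
arises from `𝒟` along the subsequence `p ∘ ρ` (`ρ` strictly increasing), it arises from `𝒟` along
`p`: re-index the far charts by `Function.extend ρ` (on the image of `ρ` they are the given ones,
elsewhere junk — the far-chart clause only constrains the charts along the convergence
subsequence) and un-subsequence (`subconvergesLocallyWithFarChartsTo_of_comp_strictMono`).
[folklore] -/
theorem TameEternalLimit.arisesFrom_of_comp_strictMono (E : TameEternalLimit)
    (𝒟 : VacuumCauchyDevelopment D) (p : ℕ → 𝒟.carrier) (ρ : ℕ → ℕ) (hρ : StrictMono ρ)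
    (h : E.ArisesFrom 𝒟 (p ∘ ρ)) : E.ArisesFrom 𝒟 p := by
  obtain ⟨Φₙ, hΦ⟩ := h
  refine ⟨Function.extend ρ Φₙ fun _ ↦ Φₙ 0,
    subconvergesLocallyWithFarChartsTo_of_comp_strictMono ρ hρ ?_⟩
  have hext : (fun m ↦ Function.extend ρ Φₙ (fun _ ↦ Φₙ 0) (ρ m)) = Φₙ :=
    funext fun m ↦ hρ.injective.extend_apply Φₙ (fun _ ↦ Φₙ 0) m
  rw [hext]
  exact hΦ

/-- **WLOG reduction for S1: it suffices to extract a limit along SOME subsequence.** If along a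
subsequence `p ∘ ρ` of the base points there is a tame eternal limit arising from `𝒟`, there is one
arising along `p` (the same `E`). This is how an extraction proof of `stub_omegaLimits` starts
(pass to a subsequence with monotone separation times / nested tame balls, then extract). [folklore] -/
theorem exists_arisesFrom_of_comp_strictMono (𝒟 : VacuumCauchyDevelopment D) (p : ℕ → 𝒟.carrier)
    (ρ : ℕ → ℕ) (hρ : StrictMono ρ) (h : ∃ E : TameEternalLimit, E.ArisesFrom 𝒟 (p ∘ ρ)) :
    ∃ E : TameEternalLimit, E.ArisesFrom 𝒟 p :=
  h.imp fun E hE ↦ E.arisesFrom_of_comp_strictMono 𝒟 p ρ hρ hE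

/-- Registered sub-goal `stub_omegaLimitsOfSubseq` of `stub_omegaLimits` (S1): the conclusion of S1
along `p` follows from the conclusion of S1 along any one subsequence `p ∘ ρ`; and the hypotheses
of S1 on the base points (outer region, escaping) pass to every subsequence. [folklore] -/
theorem stub_omegaLimitsOfSubseq :
    ∀ (X : Type) [TopologicalSpace X] [ChartedSpace Literature.Geometry.Lorentzian.E3 X] [IsManifold (modelWithCornersSelf ℝ Literature.Geometry.Lorentzian.E3) ((⊤ : ℕ∞) : WithTop ℕ∞) X] [ConnectedSpace X] (D : Literature.Geometry.Lorentzian.InitialDataSet (modelWithCornersSelf ℝ Literature.Geometry.Lorentzian.E3) X) (𝒟 : Literature.Geometry.Lorentzian.VacuumCauchyDevelopment D) [𝒟.metric.HasLeviCivita] (p : ℕ → 𝒟.carrier) (ρ : ℕ → ℕ), StrictMono ρ → ((∀ n, p n ∈ outerRegion 𝒟.toCauchyDevelopment) → ∀ m, (p ∘ ρ) m ∈ outerRegion 𝒟.toCauchyDevelopment) ∧ (IsEscaping 𝒟.toCauchyDevelopment p → IsEscaping 𝒟.toCauchyDevelopment (p ∘ ρ)) ∧ ((∃ E : TameEternalLimit,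 E.ArisesFrom 𝒟 (p ∘ ρ)) → ∃ E : TameEternalLimit, E.ArisesFrom 𝒟 p) := by
  intro X _ _ _ _ D 𝒟 _ p ρ hρ
  exact ⟨fun h ↦ forall_comp_mem h ρ, fun h ↦ h.comp_strictMono ρ hρ,
    exists_arisesFrom_of_comp_strictMono 𝒟 p ρ hρ⟩

/-! ## §4 Audit of `IsEscaping`: honest, not universal -/

/-- An escaping sequence eventually has, for every `T`, a point of `ι X` at time separation at
least `T` AND non-zero to its past; in particular (with `T = 1`) eventually `p n ∈ J⁺(ι x)` for some
`x` (`mem_causalFuture_of_lorentzDist_ne_zero`). [folklore] -/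
theorem IsEscaping.eventually_exists_lorentzDist_ne_zero {𝒟 : CauchyDevelopment D}
    {p : ℕ → 𝒟.carrier} (h : IsEscaping 𝒟 p) :
    ∀ᶠ n in atTop, ∃ x : X, 𝒟.toSpacetime.lorentzDist (𝒟.embed x) (p n) ≠ 0 ∧
      p n ∈ 𝒟.metric.causalFuture 𝒟.timeOrientation {𝒟.embed x} := by
  filter_upwards [h 1] with n hn
  obtain ⟨x, hx⟩ := hn
  have hne : 𝒟.toSpacetime.lorentzDist (𝒟.embed x) (p n) ≠ 0 := by
    intro h0
    rw [h0, ENNReal.ofReal_one] at hx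
    exact one_ne_zero (le_antisymm hx zero_le)
  exact ⟨x, hne, LorentzianMetric.mem_causalFuture_of_lorentzDist_ne_zero hne⟩

/-- An escaping sequence eventually lies in the causal future `J⁺(ι X)` of the Cauchy
hypersurface (consistent with `outerRegion ⊆ J⁺(ι X)`). [folklore] -/
theorem IsEscaping.eventually_mem_causalFuture {𝒟 : CauchyDevelopment D} {p : ℕ → 𝒟.carrier}
    (h : IsEscaping 𝒟 p) :
    ∀ᶠ n in atTop, p n ∈ 𝒟.metric.causalFuture 𝒟.timeOrientation (range 𝒟.embed) := by
  filter_upwards [h.eventually_exists_lorentzDist_ne_zero] with n hn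
  obtain ⟨x, -, hx⟩ := hn
  exact LorentzianMetric.causalFuture_mono (singleton_subset_iff.2 (mem_range_self x)) hx

/-- **The time separation between two points of the Cauchy hypersurface vanishes**: `ι X` is
acausal (`CauchyDevelopment.false_of_isFutureCausalCurveOn_range_embed`), so no future causal
segment joins `ι x` to `ι y` and the supremum defining `d(ι x, ι y)` is over the empty set.
[folklore] -/
theorem lorentzDist_embed_embed (𝒟 : CauchyDevelopment D) (x y : X) :
    𝒟.toSpacetime.lorentzDist (𝒟.embed x) (𝒟.embed y) = 0 :=
  LorentzianMetric.lorentzDist_eq_zero_iff.2 fun _ _ _ hab hγ ha hb ↦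
    (𝒟.false_of_isFutureCausalCurveOn_range_embed hab hγ (ha ▸ mem_range_self x)
      (hb ▸ mem_range_self y)).elim

/-- **No sequence of points of the Cauchy hypersurface escapes**: if every `p n` lies on `ι X`,
all time separations from `ι X` vanish (`lorentzDist_embed_embed`), so the clause of `IsEscaping`
fails at `T = 1`. Hence the hypothesis `IsEscaping` of S1 is not universal (and S1 is not made
vacuous-by-hypothesis in the other direction either: `IsEscaping` is the honest O'Neill time
separation tending to `∞`). [folklore] -/
theorem not_isEscaping_of_mem_range_embed {𝒟 : CauchyDevelopment D} {p : ℕ → 𝒟.carrier}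
    (hp : ∀ n, p n ∈ range 𝒟.embed) : ¬ IsEscaping 𝒟 p := by
  intro h
  obtain ⟨n, x, hx, -⟩ := (h.eventually_exists_lorentzDist_ne_zero).exists
  obtain ⟨y, hy⟩ := hp n
  rw [← hy, lorentzDist_embed_embed] at hx
  exact hx rfl

/-- In particular a CONSTANT sequence at a point of `ι X` does not escape. [folklore] -/
theorem not_isEscaping_const_embed (𝒟 : CauchyDevelopment D) (x : X) :
    ¬ IsEscaping 𝒟 (fun _ ↦ 𝒟.embed x) :=
  not_isEscaping_of_mem_range_embed fun _ ↦ mem_range_self x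

/-- Registered sub-goal `stub_notIsEscapingOnSigma` of `stub_omegaLimits` (S1), audit (A1): the
escaping hypothesis of S1 is not universal — no sequence on the Cauchy hypersurface escapes.
[folklore] -/
theorem stub_notIsEscapingOnSigma :
    ∀ (X : Type) [TopologicalSpace X] [ChartedSpace Literature.Geometry.Lorentzian.E3 X] [IsManifold (modelWithCornersSelf ℝ Literature.Geometry.Lorentzian.E3) ((⊤ : ℕ∞) : WithTop ℕ∞) X] [ConnectedSpace X] (D : Literature.Geometry.Lorentzian.InitialDataSet (modelWithCornersSelf ℝ Literature.Geometry.Lorentzian.E3) X) (𝒟 : Literature.Geometry.Lorentzian.CauchyDevelopment D) (p : ℕ → 𝒟.carrier), (∀ n, p n ∈ Set.range 𝒟.embed) → ¬ IsEscaping 𝒟 p := by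
  intro X _ _ _ _ D 𝒟 p hp
  exact not_isEscaping_of_mem_range_embed hp

end Development

end Summit.FinalStateConjecture.FinalStateConjecture.Theorems.TrappedSet

end
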